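import Literature.AlgebraicGeometry.Frobenioids.ArchimedeanPerfectionUnitTransport
import Literature.AlgebraicGeometry.Frobenioids.ArchimedeanPerfectionUnitsRoots
import HarnessLib

/-!
# Frobenioids II, Thm. 3.6 (i)/(v) at `Λ = ℚ`, piece P2 (vi): the unit transport read through
# `unitsPerfEquiv` — `(T-unit)` up to the Galois-twist bookkeeping of `Base ψ`

Mochizuki, *The geometry of Frobenioids II: poly-Frobenioids*, Kyushu J. Math. **62** (2008) 401–460, §3,
Thm. 3.6 (i)/(v) p. 36–37 [cite: MochizukiFrdII2008, Thm 3.6 (v) p.37]; [FrdI] Prop. 4.4 (iv) p. 83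
[cite: MochizukiFrdI2008, Prop. 4.4 (iv) p.83].

abc-iut cell, layer L1, row M13-c3 FILE A-4 (seat abc-iut-w5-d246), file 2g.  Over file 2f (`intertwines_rotUnit`) and
abc-iut-L1-t6's `unitsPerfEquiv` (`unitVal_unitsPerfEquiv_mk`):
* `unitVal_pow` — `unitVal (u^k) = k • unitVal u`;
* `unitsPerfEquiv_of_pow_eq_rotUnit` — for `A^{(c)}` complex, the power `(unitsPerfEquiv X [w])^k` IS the rotation
  unit `[rot_z]` of level `c` as soon as `τ_c(z) = w^{k·c}` (both have value `[w] ⊗ k`; `unitVal` injective);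
* `intertwines_unitsPerfEquiv_pow` — for `ψ = [ψ₀] : (A, n) → (A′, n′)` linear at adapted complex isotropic levels
  `(a, b)` and unit scalars `w`, `w′` related by the EXPLICIT twist
  `w = galAct (levelTwist X a ⊻ twists (Base ψ₀) ⊻ levelTwist X′ b) w′`, the units `(unitsPerfEquiv X [w])^{n}` and
  `(unitsPerfEquiv X′ [w′])^{n′}` are intertwined along `ψ` — the index exponents `n = X.idx`, `n′ = X′.idx` are
  forced by `n·a = n′·b`.  What separates this from abc-iut-L1-t6's `hunit` binder is (i) the exponents and (ii) the
  identification of that twist with `unitPull (π.map (Base ψ))` (structure isos of `X`, `X′` enter).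
Proof-only; nothing here bears on [IUTchIII] Cor. 3.12.
-/

noncomputable section

namespace Literature.AlgebraicGeometry.Frobenioids

open CategoryTheory Opposite
open scoped TensorProduct NNReal

universe v u

namespace ArchFrd

namespace Thm36Sub

variable {D : Type u} [Category.{v} D] {π : D ⥤ D0}

open PreFrobenioid PreFrobenioid.Perfection

section Val

variable {hF : PreFrobenioid.IsFrobenioid (C.toElem π)} (X : pfCat π hF)

/-- `unitVal (u^k) = k • unitVal u`. [cite: MochizukiFrdII2008, Thm 3.6 (v) p.37] -/
theorem unitVal_pow (u : unitsSubgroup (pfStr π hF) X) (k : ℕ) : unitVal X (u ^ k) = k • unitVal X u := by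
  apply Multiplicative.ofAdd.injective
  rw [← unitValHom_apply, map_pow, unitValHom_apply, ofAdd_nsmul]

variable {c : ℕ+} (hc : (frobPow hF X.obj c).fst.IsNaivelyIsotropic)

/-- **`(unitsPerfEquiv X [w])^k = [rot_z]`** (level `c`, `A^{(c)}` complex) whenever `τ_c(z) = w^{k c}`: both units
have value `[w] ⊗ k` in `S¹ ⊗_ℤ ℚ` and `unitVal` is injective. [cite: MochizukiFrdII2008, Thm 3.6 (v) p.37] -/
theorem unitsPerfEquiv_of_pow_eq_rotUnit (hcx : (frobPow hF X.obj c).fst.IsComplexObj)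
    (w : D0.unitScalars (π.obj X.obj.snd)) (k : ℕ) (z : ℂˣ) (hz : ‖(z : ℂ)‖ = 1)
    (h : D0.galAct (levelTwist X c) z = (w : ℂˣ) ^ (k * (c : ℕ))) :
    (unitsPerfEquiv X (Frobenioids.Perfection.of _ w)) ^ k = rotUnit X hc hcx z hz := by
  apply unitVal_injective X
  rw [unitVal_pow, Frobenioids.Perfection.of_apply, unitVal_unitsPerfEquiv_mk, unitVal_rotUnit, h,
    unitCirc_pow w.2.2, ofMul_pow, tmul_inv_eq_smul_tmul_inv _ 1 c, one_mul, TensorProduct.smul_tmul',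
    natCast_zsmul, smul_smul]

end Val

section Pf

variable {hF : PreFrobenioid.IsFrobenioid (C.toElem π)} (X X' : pfCat π hF)
  (hPf : PreFrobenioid.IsFrobenioid (pfStr π hF)) {a b : ℕ+} (e : X.idx * a = X'.idx * b)
  (hc : (frobPow hF X.obj a).fst.IsNaivelyIsotropic) (hc' : (frobPow hF X'.obj b).fst.IsNaivelyIsotropic)

include hc hc' in
/-- **Unit transport through `unitsPerfEquiv`, explicit-twist form**: for `ψ = [ψ₀]` linear at adapted complex
isotropic levels `(a, b)` (`n a = n′ b`) and unit scalars with `w = galAct (τ_a ⊻ twists (Base ψ₀) ⊻ τ_b) w′`, the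
units `(unitsPerfEquiv X [w])^{n}` and `(unitsPerfEquiv X′ [w′])^{n′}` are intertwined along `ψ`
(they are the rotations by `z = τ_a(w^{N})`, `z′ = τ_b(w′^{N})`, `N = n a = n′ b`, and `z = (Base ψ₀).act z′`).
[cite: MochizukiFrdII2008, Thm 3.6 (v) p.37] -/
theorem intertwines_unitsPerfEquiv_pow (ψ₀ : frobPow hF X.obj a ⟶ frobPow hF X'.obj b) (hψ₀ : C0.degFr ψ₀.fst = 1)
    (hcx : (frobPow hF X.obj a).fst.IsComplexObj) (hcx' : (frobPow hF X'.obj b).fst.IsComplexObj)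
    (w : D0.unitScalars (π.obj X.obj.snd)) (w' : D0.unitScalars (π.obj X'.obj.snd))
    (hw : (w : ℂˣ) = D0.galAct (xor (levelTwist X a) (xor (D0.Hom.twists (C0.Base ψ₀.fst :)) (levelTwist X' b)))
      (w' : ℂˣ)) :
    BiratUnits.Intertwines hPf (Hom.mk (⟨⟨a, b, e⟩, ψ₀⟩ : Rep X X'))
      (BiratUnits.unitsToBirat hPf X ((unitsPerfEquiv X (Frobenioids.Perfection.of _ w)) ^ (X.idx : ℕ)))
      (BiratUnits.unitsToBirat hPf X' ((unitsPerfEquiv X' (Frobenioids.Perfection.of _ w')) ^ (X'.idx : ℕ))) := by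
  -- the rotations
  have hN : (X.idx : ℕ) * (a : ℕ) = (X'.idx : ℕ) * (b : ℕ) := by exact_mod_cast congrArg PNat.val e
  set z' : ℂˣ := D0.galAct (levelTwist X' b) ((w' : ℂˣ) ^ ((X'.idx : ℕ) * (b : ℕ))) with hz'def
  set z : ℂˣ := D0.galAct (levelTwist X a) ((w : ℂˣ) ^ ((X.idx : ℕ) * (a : ℕ))) with hzdef
  have hz' : ‖(z' : ℂ)‖ = 1 := by
    rw [hz'def, D0.norm_galAct, Units.val_pow_eq_pow_val, norm_pow, w'.2.2, one_pow]
  have hz : ‖(z : ℂ)‖ = 1 := by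
    rw [hzdef, D0.norm_galAct, Units.val_pow_eq_pow_val, norm_pow, w.2.2, one_pow]
  have ez : z = (C0.Base ψ₀.fst :).act z' := by
    rw [hzdef, hz'def, hw, ← map_pow, hN, D0.galAct_xor, D0.galAct_xor, D0.Hom.act,
      D0.galAct_comm (levelTwist X a) (levelTwist X' b), D0.galAct_comm (levelTwist X a), D0.galAct_galAct]
    exact D0.galAct_comm _ _ _
  rw [unitsPerfEquiv_of_pow_eq_rotUnit X hc hcx w X.idx z hz (by rw [hzdef, D0.galAct_galAct]),
    unitsPerfEquiv_of_pow_eq_rotUnit X' hc' hcx' w' X'.idx z' hz' (by rw [hz'def, D0.galAct_galAct])]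
  exact intertwines_rotUnit X X' hPf e hc hc' ψ₀ hψ₀ hcx hcx' ez hz hz'

end Pf

end Thm36Sub

end ArchFrd

end Literature.AlgebraicGeometry.Frobenioids

end
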